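import Literature.Analysis.FluidPDE.TypeIAncientMild
import Literature.Analysis.FluidPDE.KNSSLocalSmoothingHolds
import HarnessLib

/-!
# Route ClockStretchingLaw — crux `ClockCeiling`, line `registered`: stub `stub_uniformBounds`

Helper file (supports item stmt-NavierStokesRegularity-10570, crux `ClockCeiling` of route
`ClockStretchingLaw` of `NavierStokesRegularity`): the **scale-invariant a-priori bounds for the
route's Type-I class** — for every element `u` of the class with constant `C` (jointly smooth on
`(-∞, 0) × ℝ³`, divergence-free, KNSS-mild Oseen identity between all pairs of negative times,
`‖u(t,x)‖ ≤ C/√(-t)`, local energies) and every `t < 0`,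
`‖∂ₜu(t)‖_∞ ≤ K(C)(-t)^{-3/2}`, `‖∇u(t)‖_∞ ≤ K(C)(-t)^{-1}`, `‖∇²u(t)‖_∞ ≤ K(C)(-t)^{-3/2}`,
`‖∇∂ₜu(t)‖_∞ ≤ K(C)(-t)^{-2}`, `‖∂ₜ²u(t)‖_∞ ≤ K(C)(-t)^{-5/2}`, with `K` depending on `C` only.

## Proof

Koch–Nadirashvili–Seregin–Šverák 2009, Prop. 4.1 in the uniform quantitative form
`knss2009_local_smoothing` (proved in the tree, `knss2009_local_smoothing_holds`): for `(k, l)`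
fixed there are `ε, C_{kl}` such that bounded data `‖a‖_∞ ≤ M` launch on `(s, s + ε/M²)` a smooth
solution `v` of `v = e^{(t-s)Δ}a - B¹_s(v,v)` with `(t-s)^{k/2+l}‖∇ᵏ∂ₜˡv(t)‖ ≤ C_{kl}M`. Given
`t < 0`, restart at `s = t - h`, `h = ε(-t)/(2(C+1)²)`, with the datum `a = u(s)`,
`‖u(s)‖_∞ ≤ (C+1)/√(-t) =: M` (so that the window `ε/M² = 2h` reaches beyond `t`); by uniqueness
of bounded solutions of the Oseen integral equation (`oseenMild_bounded_unique`) `u = v` on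
`(s, T) × ℝ³` for some `T > t`, so the mixed derivatives of `u` and `v` at time `t` coincide and
`h^{k/2+l}‖∇ᵏ∂ₜˡu(t,x)‖ ≤ C_{kl}(C+1)/√(-t)`, i.e.
`‖∇ᵏ∂ₜˡu(t,x)‖ ≤ C_{kl}(C+1)(2(C+1)²/ε)^{k/2+l} (-t)^{-(k+1)/2-l}`. The five bounds are the cases
`(k,l) ∈ {(0,1),(1,0),(2,0),(1,1),(0,2)}`.

## References

* G. Koch, N. Nadirashvili, G. Seregin, V. Šverák, *Liouville theorems for the Navier–Stokes
  equations and applications*, Acta Math. 203 (2009) = arXiv:0709.3599, §4 p. 8, Prop. 4.1.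
-/

set_option linter.dupNamespace false

noncomputable section

open Literature.Analysis.FluidPDE MeasureTheory Set Function Filter Topology
open Literature.Analysis.UnboundedOperators (heatExtension)
open scoped ENNReal NNReal

namespace Summit.NavierStokesRegularity.NavierStokesRegularity.Theorems

/-! ### Restart and identification with the local smooth solution -/

section Restart

variable {C ε Ckl : ℝ} {k l : ℕ} {u : ℝ → EuclideanSpace ℝ (Fin 3) → EuclideanSpace ℝ (Fin 3)}

/-- **Restart at `s = t - h` and identification** (KNSS 2009, Prop. 4.1 with the uniqueness of
bounded solutions of the Oseen integral equation): if `hL` is the local smoothing clause of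
`knss2009_local_smoothing` for `(k, l)` with constants `ε > 0`, `C_{kl} ≥ 0`, and `u` is a Type I
ancient mild field with constant `C`, then at every `t < 0`, with `h = ε(-t)/(2(C+1)²)`,
`h^{k/2} hˡ ‖∇ᵏₓ∂ₜˡu(t,x)‖ ≤ C_{kl} (C+1)/√(-t)`: the local solution from the datum `u(t-h)`
(bounded by `M = (C+1)/√(-t)`, window `ε/M² = 2h`) coincides with `u` on `(t-h, T) × ℝ³` for some
`T ∈ (t, 0)` (`oseenMild_bounded_unique`; continuous slices a.e. equal are equal), so the mixed
derivatives at time `t` agree (`Filter.EventuallyEq.iteratedDeriv_eq`). [cite: KochNadirashviliSereginSverak2009, Prop. 4.1 (arXiv:0709.3599 p. 8)] -/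
theorem uniformBounds_weighted_le_of_local
    (hL : ∀ ⦃ν : ℝ⦄, 0 < ν → ∀ (s : ℝ) ⦃M : ℝ⦄, 0 < M →
      ∀ ⦃a : EuclideanSpace ℝ (Fin 3) → EuclideanSpace ℝ (Fin 3)⦄,
      AEStronglyMeasurable a volume → eLpNorm a ∞ volume ≤ ENNReal.ofReal M →
      ∃ v : ℝ → EuclideanSpace ℝ (Fin 3) → EuclideanSpace ℝ (Fin 3),
        ContDiffOn ℝ (k + l : ℕ) (uncurry v) (Ioo s (s + ε * ν / M ^ 2) ×ˢ univ) ∧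
        (∀ t ∈ Ioo s (s + ε * ν / M ^ 2), ∀ x,
          v t x = heatExtension a (ν * (t - s)) x - oseenDuhamel ν s v v t x) ∧
        (∀ t ∈ Ioo s (s + ε * ν / M ^ 2), ∀ x, ‖v t x‖ ≤ Ckl * M) ∧
        ∀ t ∈ Ioo s (s + ε * ν / M ^ 2), ∀ x,
          (ν * (t - s)) ^ ((k : ℝ) / 2) * (t - s) ^ l *
            ‖iteratedFDeriv ℝ k (fun y => iteratedDeriv l (fun τ => v τ y) t) x‖ ≤ Ckl * M)
    (hε : 0 < ε) (hCkl : 0 ≤ Ckl) (hTI : IsTypeIAncientMild C u) {t : ℝ} (ht : t < 0)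
    (x : EuclideanSpace ℝ (Fin 3)) :
    (ε * (-t) / (2 * (C + 1) ^ 2)) ^ ((k : ℝ) / 2) * (ε * (-t) / (2 * (C + 1) ^ 2)) ^ l *
        ‖iteratedFDeriv ℝ k (fun y => iteratedDeriv l (fun τ => u τ y) t) x‖ ≤
      Ckl * ((C + 1) / Real.sqrt (-t)) := by
  have hC : 0 ≤ C := hTI.nonneg
  have hC₁ : 0 < C + 1 := by linarith
  have hnt : 0 < -t := neg_pos.2 ht
  have hsqrt : 0 < Real.sqrt (-t) := Real.sqrt_pos.2 hnt
  -- the bound `M` on `(-∞, t]` and the half-window `h`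
  set M : ℝ := (C + 1) / Real.sqrt (-t) with hM
  have hM0 : 0 < M := div_pos hC₁ hsqrt
  set h : ℝ := ε * (-t) / (2 * (C + 1) ^ 2) with hh
  have hh0 : 0 < h := by rw [hh]; positivity
  have hM2 : M ^ 2 = (C + 1) ^ 2 / (-t) := by
    rw [hM, div_pow, Real.sq_sqrt hnt.le]
  have hwin : ε * 1 / M ^ 2 = 2 * h := by
    rw [hM2, hh]
    field_simp
  -- the initial time `s` and the uniqueness window `(s, T) ∋ t`
  set s : ℝ := t - h with hs
  have hst : s < t := by rw [hs]; linarith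
  have hs0 : s < 0 := hst.trans ht
  have hts : t - s = h := by rw [hs]; ring
  set T : ℝ := min (s + ε * 1 / M ^ 2) (t / 2) with hT
  have htT : t < T := lt_min (by rw [hwin, hs]; linarith) (by linarith)
  have hTw : T ≤ s + ε * 1 / M ^ 2 := min_le_left _ _
  have hT2 : T ≤ t / 2 := min_le_right _ _
  have hT0 : T < 0 := by linarith
  -- the datum `u s`, bounded by `M`
  have hbd : ∀ τ < t, ∀ y, ‖u τ y‖ ≤ M := by
    intro τ hτ y
    have h1 : ‖u τ y‖ ≤ C / Real.sqrt (-t) :=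
      hTI.norm_le_of_mem_Ioo ht ⟨show τ - 1 < τ by linarith, hτ⟩ y
    exact h1.trans (div_le_div_of_nonneg_right (by linarith) hsqrt.le)
  have ha : AEStronglyMeasurable (u s) volume := hTI.aestronglyMeasurable_slice hs0
  have haM : eLpNorm (u s) ∞ volume ≤ ENNReal.ofReal M := by
    rw [eLpNorm_exponent_top]
    exact eLpNormEssSup_le_of_ae_bound (Eventually.of_forall fun y => hbd s hst y)
  obtain ⟨v, hvcd, hveq, hvbd, hvw⟩ := hL one_pos s hM0 ha haM
  -- uniqueness of bounded solutions on `(s, T)`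
  have hMu0 : 0 ≤ max (C / Real.sqrt (-(t / 2))) (Ckl * M) :=
    (mul_nonneg hCkl hM0.le).trans (le_max_right _ _)
  have hum : AEStronglyMeasurable (uncurry u)
      ((volume : Measure (ℝ × EuclideanSpace ℝ (Fin 3))).restrict (Ioo s T ×ˢ univ)) :=
    hTI.aestronglyMeasurable_uncurry hT0.le
  have hvm : AEStronglyMeasurable (uncurry v)
      ((volume : Measure (ℝ × EuclideanSpace ℝ (Fin 3))).restrict (Ioo s T ×ˢ univ)) :=
    (hvcd.continuousOn.mono (prod_mono (Ioo_subset_Ioo_right hTw) Subset.rfl)).aestronglyMeasurable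
      (measurableSet_Ioo.prod MeasurableSet.univ)
  have huniq : ∀ τ ∈ Ioo s T, u τ =ᵐ[volume] v τ :=
    oseenMild_bounded_unique (ν := 1) (s := s) (T := T)
      (M := max (C / Real.sqrt (-(t / 2))) (Ckl * M)) (u := u) (v := v)
      (U := fun τ y => heatExtension (u s) (τ - s) y) one_pos hMu0 hum hvm
      (fun τ hτ y => (hTI.norm_le_of_mem_Ioo (t := t / 2) (by linarith)
        ⟨hτ.1, hτ.2.trans_le hT2⟩ y).trans (le_max_left _ _))
      (fun τ hτ y => (hvbd τ ⟨hτ.1, hτ.2.trans_le hTw⟩ y).trans (le_max_right _ _))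
      (fun τ hτ => Eventually.of_forall (hTI.mild_eq_heatExtension hτ.1 (hτ.2.trans hT0)))
      (fun τ hτ => Eventually.of_forall fun y => by
        have h1 := hveq τ ⟨hτ.1, hτ.2.trans_le hTw⟩ y
        rwa [one_mul] at h1)
  have hueq : ∀ τ ∈ Ioo s T, u τ = v τ := by
    intro τ hτ
    have hcu : Continuous (u τ) := hTI.continuous_slice (hτ.2.trans hT0)
    have hcv : Continuous (v τ) :=
      hvcd.continuousOn.comp_continuous (f := fun y => (τ, y)) (by fun_prop)
        fun y => mk_mem_prod ⟨hτ.1, hτ.2.trans_le hTw⟩ (mem_univ _)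
    exact (Continuous.ae_eq_iff_eq volume hcu hcv).1 (huniq τ hτ)
  -- transfer of the mixed derivative at time `t` from `v` to `u`
  have hfun : (fun y => iteratedDeriv l (fun τ => u τ y) t) =
      fun y => iteratedDeriv l (fun τ => v τ y) t := by
    funext y
    refine Filter.EventuallyEq.iteratedDeriv_eq l ?_
    filter_upwards [Ioo_mem_nhds hst htT] with τ hτ
    rw [hueq τ hτ]
  have hw := hvw t ⟨hst, htT.trans_le hTw⟩ x
  rw [one_mul, hts, ← hfun] at hw
  exact hw

end Restart

/-! ### The scale-invariant form of the weighted bound -/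

/-- **Arithmetic of the parabolic weights.** If `h^{k/2} hˡ D ≤ C_{kl}(C+1)/√(-t)` with
`h = ε(-t)/(2(C+1)²)`, `ε > 0`, `C ≥ 0`, `t < 0`, and `e + (k/2 + l) = -1/2`, then
`D ≤ C_{kl}(C+1)/(ε/(2(C+1)²))^{k/2+l} · (-t)^e` (`h^{k/2+l} = (ε/(2(C+1)²))^{k/2+l}(-t)^{k/2+l}`,
`1/√(-t) = (-t)^e (-t)^{k/2+l}`). [folklore] -/
theorem uniformBounds_le_of_weighted {k l : ℕ} {e ε Ckl C t D : ℝ}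
    (he : e + ((k : ℝ) / 2 + l) = -(1 / 2)) (hε : 0 < ε) (hC : 0 ≤ C) (ht : t < 0)
    (hw : (ε * (-t) / (2 * (C + 1) ^ 2)) ^ ((k : ℝ) / 2) * (ε * (-t) / (2 * (C + 1) ^ 2)) ^ l * D ≤
      Ckl * ((C + 1) / Real.sqrt (-t))) :
    D ≤ Ckl * (C + 1) / (ε / (2 * (C + 1) ^ 2)) ^ ((k : ℝ) / 2 + l) * (-t) ^ e := by
  have hnt : 0 < -t := neg_pos.2 ht
  have hC₁ : 0 < C + 1 := by linarith
  have hA0 : 0 < ε / (2 * (C + 1) ^ 2) := by positivity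
  have hAp : 0 < (ε / (2 * (C + 1) ^ 2)) ^ ((k : ℝ) / 2 + l) := Real.rpow_pos_of_pos hA0 _
  have htp : 0 < (-t) ^ ((k : ℝ) / 2 + l) := Real.rpow_pos_of_pos hnt _
  have h1 : (ε * (-t) / (2 * (C + 1) ^ 2)) ^ ((k : ℝ) / 2) * (ε * (-t) / (2 * (C + 1) ^ 2)) ^ l =
      (ε / (2 * (C + 1) ^ 2)) ^ ((k : ℝ) / 2 + l) * (-t) ^ ((k : ℝ) / 2 + l) := by
    rw [show ε * (-t) / (2 * (C + 1) ^ 2) = ε / (2 * (C + 1) ^ 2) * (-t) by ring,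
      ← Real.rpow_natCast _ l, ← Real.rpow_add (mul_pos hA0 hnt), Real.mul_rpow hA0.le hnt.le]
  have h2 : (C + 1) / Real.sqrt (-t) = (C + 1) * ((-t) ^ e * (-t) ^ ((k : ℝ) / 2 + l)) := by
    rw [← Real.rpow_add hnt, he, Real.rpow_neg hnt.le, Real.sqrt_eq_rpow]
    exact div_eq_mul_inv _ _
  rw [h1, h2] at hw
  have h3 : (ε / (2 * (C + 1) ^ 2)) ^ ((k : ℝ) / 2 + l) * D * (-t) ^ ((k : ℝ) / 2 + l) ≤
      Ckl * (C + 1) * (-t) ^ e * (-t) ^ ((k : ℝ) / 2 + l) := by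
    convert hw using 1 <;> ring
  have key := le_of_mul_le_mul_right h3 htp
  rw [show Ckl * (C + 1) / (ε / (2 * (C + 1) ^ 2)) ^ ((k : ℝ) / 2 + l) * (-t) ^ e =
      Ckl * (C + 1) * (-t) ^ e / (ε / (2 * (C + 1) ^ 2)) ^ ((k : ℝ) / 2 + l) by ring,
    le_div_iff₀ hAp, mul_comm D]
  exact key

/-- **KNSS 2009, Prop. 4.1, scale-invariant form, one pair `(k, l)`:** there is `K = K_{kl}(C) ≥ 0`
(for `C ≥ 0`) such that every Type I ancient mild field `u` with constant `C` satisfies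
`‖∇ᵏₓ∂ₜˡu(t,x)‖ ≤ K(C) (-t)^e` for all `t < 0`, `x`, where `e = -(k+1)/2 - l`; explicitly
`K(C) = C_{kl}(C+1)(2(C+1)²/ε)^{k/2+l}` with the constants `ε, C_{kl}` of
`knss2009_local_smoothing_holds`. [cite: KochNadirashviliSereginSverak2009, Prop. 4.1 (arXiv:0709.3599 p. 8)] -/
theorem uniformBounds_exists_mixed (k l : ℕ) (e : ℝ) (he : e + ((k : ℝ) / 2 + l) = -(1 / 2)) :
    ∃ K : ℝ → ℝ, (∀ C, 0 ≤ C → 0 ≤ K C) ∧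
      ∀ (C : ℝ) (u : ℝ → EuclideanSpace ℝ (Fin 3) → EuclideanSpace ℝ (Fin 3)),
        IsTypeIAncientMild C u → ∀ t : ℝ, t < 0 → ∀ x : EuclideanSpace ℝ (Fin 3),
          ‖iteratedFDeriv ℝ k (fun y => iteratedDeriv l (fun τ => u τ y) t) x‖ ≤ K C * (-t) ^ e := by
  obtain ⟨ε, hε, Ckl, hCkl, hL⟩ := knss2009_local_smoothing_holds (EuclideanSpace ℝ (Fin 3)) k l
  refine ⟨fun C => Ckl * (C + 1) / (ε / (2 * (C + 1) ^ 2)) ^ ((k : ℝ) / 2 + l),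
    fun C hC => ?_, fun C u hTI t ht x => ?_⟩
  · have hC₁ : 0 < C + 1 := by linarith
    positivity
  · exact uniformBounds_le_of_weighted he hε hTI.nonneg ht
      (uniformBounds_weighted_le_of_local hL hε hCkl hTI ht x)

/-! ### The stub -/

/-- **Stub `stub_uniformBounds` — scale-invariant sup bounds for the Type-I class** (KNSS 2009
Prop. 4.1 in the uniform quantitative form `knss2009_local_smoothing`, restarted at
`s = t - ε(-t)/(2(C+1)²)` and identified with `u` by uniqueness of bounded Oseen-mild solutions;
the constant depends on `C` only): for every element `u` of the route's Type-I class with constant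
`C` and every `t < 0`, `x`, `‖∂ₜu(t,x)‖ ≤ K(C)(-t)^{-3/2}`, `‖∇u(t,x)‖ ≤ K(C)(-t)^{-1}`,
`‖∇²u(t,x)‖ ≤ K(C)(-t)^{-3/2}`, `‖∇∂ₜu(t,x)‖ ≤ K(C)(-t)^{-2}`, `‖∂ₜ²u(t,x)‖ ≤ K(C)(-t)^{-5/2}`.
The first four clauses of the class hypothesis are literally `IsTypeIAncientMild C u`
(`isTypeIAncientMild_iff`); `K` is the sum of the five constants `K_{kl}`,
`(k,l) ∈ {(0,1),(1,0),(2,0),(1,1),(0,2)}`, of `uniformBounds_exists_mixed`. [cite: KochNadirashviliSereginSverak2009, Prop. 4.1 (arXiv:0709.3599 p. 8)] -/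
theorem stub_uniformBounds :
    ∃ K : ℝ → ℝ, ∀ (C : ℝ) (u : ℝ → EuclideanSpace ℝ (Fin 3) → EuclideanSpace ℝ (Fin 3)), ContDiffOn ℝ (⊤ : ℕ∞) (Function.uncurry u) (Set.Iio 0 ×ˢ Set.univ) ∧ (∀ t < 0, Literature.Analysis.FluidPDE.VectorCalculus.IsDivFree (u t)) ∧ (∀ s t : ℝ, s < t → t < 0 → ∀ x, u t x = Literature.Analysis.FluidPDE.heatFlow (u s) (t - s) x - ∫ τ in Set.Ioo s t, ∫ y, ((-(inner ℝ (x - y) (u τ y) / (2 * (t - τ)) * Literature.Analysis.UnboundedOperators.heatKernel (t - τ) (x - y))) • u τ y + (∫ σ in Set.Ioi (t - τ), Literature.Analysis.UnboundedOperators.heatKernel σ (x - y) / (4 * σ ^ 2)) • (inner ℝ (x - y) (u τ y) • u τ y + inner ℝ (u τ y) (u τ y) • (x - y) + inner ℝ (x - y) (u τ y) • u τ y) - ((∫ σ in Set.Ioi (t - τ), Literature.Analysis.UnboundedOperators.heatKernel σ (x - y) / (8 * σ ^ 3)) * (inner ℝ (x - y) (u τ y) * inner ℝ (x - y) (u τ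 y))) • (x - y))) ∧ Literature.Analysis.FluidPDE.HasTypeITimeDecay C u ∧ (∀ (x₀ : EuclideanSpace ℝ (Fin 3)) (t₀ r : ℝ), t₀ ≤ 0 → 0 < r → (∀ t, t₀ - r ^ 2 < t → t < t₀ → r⁻¹ * ∫ x in Metric.ball x₀ r, ‖u t x‖ ^ 2 ≤ C) ∧ r⁻¹ * ∫ t in Set.Ioo (t₀ - r ^ 2) t₀, ∫ x in Metric.ball x₀ r, ‖fderiv ℝ (u t) x‖ ^ 2 ≤ C) → ∀ t : ℝ, t < 0 → ∀ x : EuclideanSpace ℝ (Fin 3), ‖Literature.Analysis.FluidPDE.timeDeriv u t x‖ ≤ K C * (-t) ^ (-(3 : ℝ) / 2) ∧ ‖fderiv ℝ (u t) x‖ ≤ K C * (-t) ^ (-(1 : ℝ)) ∧ ‖iteratedFDeriv ℝ 2 (u t) x‖ ≤ K C * (-t) ^ (-(3 : ℝ) / 2) ∧ ‖fderiv ℝ (fun y => Literature.Analysis.FluidPDE.timeDeriv u t y) x‖ ≤ K C * (-t) ^ (-(2 : ℝ)) ∧ ‖iteratedDeriv 2 (fun s => u s x) t‖ ≤ K C *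 (-t) ^ (-(5 : ℝ) / 2) := by
  obtain ⟨K₁, hK₁0, hK₁⟩ := uniformBounds_exists_mixed 0 1 (-(3 : ℝ) / 2) (by norm_num)
  obtain ⟨K₂, hK₂0, hK₂⟩ := uniformBounds_exists_mixed 1 0 (-(1 : ℝ)) (by norm_num)
  obtain ⟨K₃, hK₃0, hK₃⟩ := uniformBounds_exists_mixed 2 0 (-(3 : ℝ) / 2) (by norm_num)
  obtain ⟨K₄, hK₄0, hK₄⟩ := uniformBounds_exists_mixed 1 1 (-(2 : ℝ)) (by norm_num)
  obtain ⟨K₅, hK₅0, hK₅⟩ := uniformBounds_exists_mixed 0 2 (-(5 : ℝ) / 2) (by norm_num)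
  refine ⟨fun C => K₁ C + K₂ C + K₃ C + K₄ C + K₅ C, ?_⟩
  intro C u hu t ht x
  beta_reduce
  have hTI : IsTypeIAncientMild C u :=
    isTypeIAncientMild_iff.2 ⟨hu.1, hu.2.1, hu.2.2.1, hu.2.2.2.1⟩
  have hC : 0 ≤ C := hTI.nonneg
  have e₁ := hK₁0 C hC
  have e₂ := hK₂0 C hC
  have e₃ := hK₃0 C hC
  have e₄ := hK₄0 C hC
  have e₅ := hK₅0 C hC
  have hp : ∀ e : ℝ, 0 ≤ (-t) ^ e := fun e => Real.rpow_nonneg (neg_pos.2 ht).le e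
  have h₁ := hK₁ C u hTI t ht x
  have h₂ := hK₂ C u hTI t ht x
  have h₃ := hK₃ C u hTI t ht x
  have h₄ := hK₄ C u hTI t ht x
  have h₅ := hK₅ C u hTI t ht x
  simp only [norm_iteratedFDeriv_zero, norm_iteratedFDeriv_one, iteratedDeriv_one,
    iteratedDeriv_zero] at h₁ h₂ h₃ h₄ h₅
  refine ⟨?_, ?_, ?_, ?_, ?_⟩
  · rw [timeDeriv_apply]
    exact h₁.trans (mul_le_mul_of_nonneg_right (by linarith) (hp _))
  · exact h₂.trans (mul_le_mul_of_nonneg_right (by linarith) (hp _))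
  · exact h₃.trans (mul_le_mul_of_nonneg_right (by linarith) (hp _))
  · simp only [timeDeriv_apply]
    exact h₄.trans (mul_le_mul_of_nonneg_right (by linarith) (hp _))
  · exact h₅.trans (mul_le_mul_of_nonneg_right (by linarith) (hp _))

end Summit.NavierStokesRegularity.NavierStokesRegularity.Theorems

end
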